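import Summits.BirchSwinnertonDyer.BirchSwinnertonDyer.Theorems.AlignedTransportAtTwoMainConjectureOfRankZeroBSDAtTwoCubicDepthDoor
import Summits.BirchSwinnertonDyer.BirchSwinnertonDyer.Theorems.AlignedTransportAtTwoMainConjectureOfRankZeroBSDAtTwoCubicPrimesOfEmbeddings
import Summits.BirchSwinnertonDyer.BirchSwinnertonDyer.Theorems.AlignedTransportAtTwoMainConjectureOfRankZeroBSDAtTwoCubicOffStratumRamification
import Literature.NumberTheory.IwasawaTheory.ClassGroupPRankLeOneOfAmbiguousLayerTwoOddIndex
import HarnessLib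

/-!
# Route `AlignedTransportAtTwo`, crux C2 `MainConjectureOfRankZeroBSDAtTwo` (stmt-BirchSwinnertonDyer-22298):
# THE DEPTH DOOR INTO `MC₂(W)` ON `Δ_min ≡ 1 (mod 4)` WITH THE RAMIFICATION HYPOTHESIS DISCHARGED — only `h(ℚ(β))` odd, `ord₂ h(ℚ(β,√2)) ≤ 1`
# and the unit norm index `[E_{ℚ(β)} : E_{ℚ(β)} ∩ N_{K_2/ℚ(β)} K_2ˣ] = 1` remain displayed

HONEST FRAMING (cell `bsd-f1-sign2`, WIDTH-5 attached prover seat `bsd-line-att-p3` gen 42 on line `birth` of the lead `bsd-line-att-p2`;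
`--supports` stmt-BirchSwinnertonDyer-22298, closes nothing; BSD is NOT proved by any of this; the crux C2, its verdict «blocked-on
`Rank1Residual.GreenbergMuConjectureIrreducible`» and every registered stub are untouched).  THEOREMS ONLY — no definition, no named fact, no `sorry`.
Sequel of this gen's `…CubicDepthDoor` (the depth door with «at least two primes of `ℚ(β)` ramified in `K_2`» displayed).

WHY / WHAT.  For a globally minimal good-ordinary `W` with no rational `2`-torsion abscissa and `Δ_min ≡ 1 (mod 4)`, every prime of the cubic `2`-torsion
field `ℚ(β)` above `2` has odd `e(w|2)` (att-p5 `forall_odd_ramificationIdx_adjoin_iff_minimalDiscriminantInt_emod_four_eq_one`), there are at least two of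
them (att-p5 g26 `two_le_ncard_of_isOrdinaryAt_two`: the canonical `2`-adic root gives an `e = f = 1` prime), and each ramifies in every layer of a cyclotomic
`ℤ₂`-extension (`√2 ∈ K_1`; Literature `ClassGroupPRankLeOneOfAmbiguousLayerTwoOddIndex`, this seat).  So the depth door needs only:
* **`classGroupPRank_le_one_adjoin_of_depthDoor_of_emod_four_eq_one`** — displayed `h(ℚ(β))` odd, `ord₂ h(K_1) ≤ 1`, `[E : E ∩ N_{K_2/ℚ(β)} K_2ˣ] = 1` ⟹
  `rank₂ Cl(K_m) ≤ 1 ∀ m`, `μ₂ = 0`, `λ₂ ≤ 1` for the cyclotomic `κ` of `ℚ(β)`;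
* **`mazurMainConjecture_two_of_muIneqRel_of_depthDoor_of_emod_four_eq_one`** — PRINT⁵ + MuIneqʳ + the cell hypotheses (`Δ_W < 0`) + `Δ_min ≡ 1 (mod 4)` + the
  same for every cyclotomic `κ` ⟹ `MC₂(W)` (att-p5 g24 carrier road).
On the census sub-cell `Δ_min ≡ 5 (mod 8)`, `h` odd, `σ₁(ε) ≡ ±1 (mod 16)` the unit norm index IS `1` (local class field theory, census-grade: `−1 = N(1+√2)`-type
and the norm group `2^ℤ·±(1+16ℤ₂)` of `ℚ₂(√(2+√2))`), so per seed the open data are ONE sextic class-number parity (`e₁ = 1`) and two norm identities in `ℚ(β,θ)`.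

CONDITIONAL theorems (PRINT⁵, MuIneqʳ displayed); nothing is asserted about any seed; nothing is closed; BSD is not proved.

References: [Washington1997] §13.1 Prop. 13.2, §13.3 Prop. 13.22–13.23; [Lang1990] Ch. 13 §4, Lemma 4.1; [Fukuda1994] Thm. 1, p. 264; [NeukirchANT1999] Ch. I §8
Prop. (8.2), Ch. IV §6, Ch. VI §7 Thm. (7.1); [Kato2004Asterisque] Thm. 17.4 (1)(2) (p. 273); [GreenbergLNM1716] Thm. 4.1 (p. 102), Conj. 1.11 (p. 58); tree: att-p5
g24 `…CubicCarrierRoad`, g26 `…CubicPrimesOfEmbeddings`, `…CubicOffStratumRamification`, `…CubicKilfordPrimes`; this seat's `…CubicDepthDoor` and Literature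
`IwasawaTheory/ClassGroupPRankLeOneOfAmbiguousLayerTwo{,OddIndex}`.
-/

set_option linter.dupNamespace false
set_option autoImplicit false

noncomputable section

open scoped Classical NumberField nonZeroDivisors

namespace Summit.BirchSwinnertonDyer.BirchSwinnertonDyer.Theorems.AlignedTransportAtTwoCubicDepthDoorOddIndex

open NumberField IsDedekindDomain Polynomial WeierstrassCurve IntermediateField CongruenceSubgroup
  Literature.NumberTheory.IwasawaTheory Literature.NumberTheory.GaloisRepresentations
  Literature.NumberTheory.GaloisRepresentations.Herbrand Literature.NumberTheory.GaloisRepresentations.MinkowskiUnit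
  Literature.NumberTheory.GaloisRepresentations.CyclicNormIndex
  Literature.NumberTheory.EllipticCurves Literature.NumberTheory.EllipticCurves.Greenberg1999
  Literature.NumberTheory.EllipticCurves.ModularForms
  Literature.NumberTheory.EllipticCurves.Rank1Residual
  Literature.NumberTheory.EllipticCurves.Module
  Summit.BirchSwinnertonDyer.Rank1Residual
  Summit.BirchSwinnertonDyer.Rank1Residual.X1.MuLambda
  Summit.BirchSwinnertonDyer.Rank1Residual.X5
  Summit.BirchSwinnertonDyer.Rank1Residual.F1Sign2
  Summit.BirchSwinnertonDyer.BirchSwinnertonDyer.Theorems.Rank1ResidualX1Defs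
  Summit.BirchSwinnertonDyer.BirchSwinnertonDyer.Theses.AlignedTransportAtTwo
  Summit.BirchSwinnertonDyer.BirchSwinnertonDyer.Theorems.AlignedTransportAtTwoKilfordStratumShared
  Summit.BirchSwinnertonDyer.BirchSwinnertonDyer.Theorems.AlignedTransportAtTwoCubicCarrierRoad
  Summit.BirchSwinnertonDyer.BirchSwinnertonDyer.Theorems.AlignedTransportAtTwoCubicKilfordPrimes
  Summit.BirchSwinnertonDyer.BirchSwinnertonDyer.Theorems.AlignedTransportAtTwoCubicPrimesOfEmbeddings
  Summit.BirchSwinnertonDyer.BirchSwinnertonDyer.Theorems.AlignedTransportAtTwoCubicOffStratumRamification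
  Summit.BirchSwinnertonDyer.BirchSwinnertonDyer.Theorems.AlignedTransportAtTwoCubicDepthDoor

variable (W : WeierstrassCurve ℚ) [W.IsElliptic] [W.IsGloballyMinimal]

/-! ## §1 `rank₂ ≤ 1`, `μ₂ = 0`, `λ₂ ≤ 1` on `Δ_min ≡ 1 (mod 4)` from `h` odd, `e₁ ≤ 1` and the unit norm index -/

/-- **THE DEPTH DOOR ON `Δ_min ≡ 1 (mod 4)`, ramification hypothesis discharged.**  `W/ℚ` globally minimal, good ordinary at `2`, no rational `2`-torsion
abscissa, `Δ_min ≡ 1 (mod 4)`, `β ∈ ℚ̄` a root of the `2`-division cubic, `κ` a cyclotomic `ℤ₂`-extension of `ℚ(β)`; displayed: `h(ℚ(β))` odd,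
`ord₂ h(K_1) ≤ 1`, and `[E_{ℚ(β)} : E_{ℚ(β)} ∩ N_{K_2/ℚ(β)} K_2ˣ] = 1` inside `K_2ˣ`.  THEN `rank₂ Cl(K_m) ≤ 1` for all `m`, `μ₂(κ) = 0`, `λ₂(κ) ≤ 1`.  (Every prime of
`ℚ(β)` above `2` has odd `e(w|2)` — `Δ_min ≡ 1 (4)` —, there are at least two of them — the canonical `2`-adic root —, and each ramifies in `K_2` — `√2 ∈ K_1`.)
[cite: Washington1997, §13.3 Prop. 13.22–13.23] [cite: Lang1990, Ch. 13 §4, Lemma 4.1 (PDF pp. 203–204)] [cite: Fukuda1994, Thm. 1, p. 264]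
[cite: NeukirchANT1999, Ch. I §8 Prop. (8.2) and Ch. IV §6, Ch. VI §7 Thm. (7.1)] -/
theorem classGroupPRank_le_one_adjoin_of_depthDoor_of_emod_four_eq_one (hord : IsOrdinaryAt W 2)
    (ht : ∀ x : ℚ, ¬ HasRationalTwoTorsionX W x) (h41 : minimalDiscriminantInt W % 4 = 1)
    {β : AlgebraicClosure ℚ} (hβ : aeval β W.twoTorsionPolynomial.toPoly = 0)
    (hh : haveI : FiniteDimensional ℚ ↥(IntermediateField.adjoin ℚ ({β} : Set (AlgebraicClosure ℚ))) :=
        IntermediateField.adjoin.finiteDimensional ((AlgebraicClosure.isAlgebraic ℚ).isAlgebraic β).isIntegral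
      haveI : NumberField ↥(IntermediateField.adjoin ℚ ({β} : Set (AlgebraicClosure ℚ))) := NumberField.mk
      ¬ 2 ∣ classNumber ↥(IntermediateField.adjoin ℚ ({β} : Set (AlgebraicClosure ℚ))))
    (κP : ZpExtension ↥(IntermediateField.adjoin ℚ ({β} : Set (AlgebraicClosure ℚ))) 2) (hκP : κP.IsCyclotomic)
    [FiniteDimensional ↥(IntermediateField.adjoin ℚ ({β} : Set (AlgebraicClosure ℚ))) (κP.layer 2)] [NumberField (κP.layer 2)]
    (he1 : classNumberPExp κP 1 ≤ 1)
    (hidx : (unitsE (κP.layer 2) ⊓ (⊤ : Subgroup (κP.layer 2)ˣ).map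
        (Herbrand.norm ((κP.layer 2) ≃ₐ[↥(IntermediateField.adjoin ℚ ({β} : Set (AlgebraicClosure ℚ)))] (κP.layer 2)))).relIndex
        (unitsE (κP.layer 2) ⊓ (unitsIncl ↥(IntermediateField.adjoin ℚ ({β} : Set (AlgebraicClosure ℚ))) (κP.layer 2)).range) = 1) :
    (∀ m : ℕ, classGroupPRank κP m ≤ 1) ∧ ClassicalMuVanishes κP ∧ classicalLambda κP ≤ 1 := by
  have hirr := AlignedTransportAtTwoSeed.irr_two_of_forall_not_hasRationalTwoTorsionX W ht
  have hβint : IsIntegral ℚ β := ((AlgebraicClosure.isAlgebraic ℚ).isAlgebraic β).isIntegral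
  haveI : FiniteDimensional ℚ ↥(IntermediateField.adjoin ℚ ({β} : Set (AlgebraicClosure ℚ))) :=
    IntermediateField.adjoin.finiteDimensional hβint
  haveI : NumberField ↥(IntermediateField.adjoin ℚ ({β} : Set (AlgebraicClosure ℚ))) := NumberField.mk
  have h3 : Module.finrank ℚ ↥(IntermediateField.adjoin ℚ ({β} : Set (AlgebraicClosure ℚ))) = 3 :=
    AddKatoTwo.finrank_adjoin_root_twoTorsionPolynomial_eq_three W hirr hβ
  have hodd3 : ¬ 2 ∣ Module.finrank ℚ ↥(IntermediateField.adjoin ℚ ({β} : Set (AlgebraicClosure ℚ))) := by rw [h3]; decide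
  have hodd := (forall_odd_ramificationIdx_adjoin_iff_minimalDiscriminantInt_emod_four_eq_one W hord ht hβ).mpr h41
  have h2 := two_le_ncard_of_isOrdinaryAt_two ↥(IntermediateField.adjoin ℚ ({β} : Set (AlgebraicClosure ℚ))) W hord ht h3
    (AlignedTransportAtTwoCubicKilfordPrimes.aeval_four_mul_gen_twoDivisionUCubic W hβ)
  exact classGroupPRank_le_one_of_relIndex_unitsNorm_eq_one_of_forall_odd_ramificationIdx hodd3 κP hκP hodd hh he1 h2 hidx

/-! ## §2 The door into `MC₂(W)` -/

/-- **THE DEPTH DOOR INTO `MC₂(W)` ON `Δ_min ≡ 1 (mod 4)`.**  PRINT⁵ {Kato 17.4 (1)(2) at `2` (`h17`), Greenberg 4.1 (`hGr`), period unit (`hper`), modularity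
(`hmod`), GZK (`hGZK`)} + MuIneqʳ (`hI`, the registered stub VERBATIM) + the cell hypotheses (good ordinary at `2`, no rational `2`-torsion abscissa, `Δ_W < 0`,
`r_an = 0`, analytic `μ₂ = 0` on the even branch, `BSD₂(W)`) + `Δ_min ≡ 1 (mod 4)` + `β` a root of the `2`-division cubic + displayed: `h(ℚ(β))` odd and, for every
cyclotomic `ℤ₂`-extension `κ` of `ℚ(β)`, `ord₂ h(K_1) ≤ 1` and `[E_{ℚ(β)} : E_{ℚ(β)} ∩ N_{K_2/ℚ(β)} K_2ˣ] = 1` ⟹ `MC₂(W)` (att-p5 g24's cubic carrier road ∘ §1).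
[cite: Fukuda1994, Thm. 1, p. 264] [cite: Kato2004Asterisque, Thm. 17.4 (1)(2) (p. 273)] [cite: GreenbergLNM1716, Thm. 4.1 (p. 102) and Conj. 1.11 (p. 58)]
[cite: Lang1990, Ch. 13 §4, Lemma 4.1 (PDF pp. 203–204)] [cite: Washington1997, §13.3 Prop. 13.22–13.23] -/
theorem mazurMainConjecture_two_of_muIneqRel_of_depthDoor_of_emod_four_eq_one
    (h17 : ∀ [NeZero (W.conductorNorm ℤ)] (f : CuspForm (Gamma0 (W.conductorNorm ℤ)) 2),
      kato_divisibility_allPrimes W 2 (f := f))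
    (hGr : Greenberg1999.thm41_charValue_rankZero_anyPrime)
    (hper : realPeriodRat_eq_unit_mul_plusPeriod_two) (hmod : nonempty_modularParametrizationData)
    (hGZK : rank_eq_analyticRank_of_analyticRank_le_one)
    (hI : ∀ (W : WeierstrassCurve ℚ) [W.IsElliptic] [W.IsGloballyMinimal], IsOrdinaryAt W 2 →
      (∀ x : ℚ, ¬ HasRationalTwoTorsionX W x) →
      ∀ (κ : ZpExtension ℚ 2) (γ : Field.absoluteGaloisGroup ℚ), κ.IsCyclotomic →
      κ.IsTopGenerator γ → IsCyclotomicVariable 2 γ →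
      ∀ ⦃N : ℕ⦄ [NeZero N] (f : CuspForm (Gamma0 N) 2), IsNewformOf W f →
      ∀ Gp : IwasawaAlgebra 2, iwasawaToPowerSeries 2 Gp = padicLFunction f (unitRoot W 2 : ℚ_[2]) →
      ∀ (D : W.SelmerDualData κ γ) (Yr : W.FineSelmerDualDataRelaxedInf κ γ),
        lengthAt (IwasawaAlgebra 2) D.X ⟨IwasawaAlgebra.augIdealP 2, IwasawaAlgebra.isPrime_augIdealP_holds 2⟩ ≤
          lengthAt (IwasawaAlgebra 2) (IwasawaAlgebra 2 ⧸ Ideal.span {Gp})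
              ⟨IwasawaAlgebra.augIdealP 2, IwasawaAlgebra.isPrime_augIdealP_holds 2⟩ +
            lengthAt (IwasawaAlgebra 2) Yr.X ⟨IwasawaAlgebra.augIdealP 2, IwasawaAlgebra.isPrime_augIdealP_holds 2⟩)
    (hord : IsOrdinaryAt W 2) (ht : ∀ x : ℚ, ¬ HasRationalTwoTorsionX W x) (hΔ : W.Δ < 0) (hr : W.analyticRank = 0)
    (hμan : ∀ ⦃N : ℕ⦄ [NeZero N] (f : CuspForm (Gamma0 N) 2), IsNewformOf W f →
      ∀ G : IwasawaAlgebra 2, IsEvenBranchLiftAtTwo W f G → red G ≠ 0)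
    (hbsd : BSDp W 2) (h41 : minimalDiscriminantInt W % 4 = 1)
    {β : AlgebraicClosure ℚ} (hβ : aeval β W.twoTorsionPolynomial.toPoly = 0)
    (hh : haveI : FiniteDimensional ℚ ↥(IntermediateField.adjoin ℚ ({β} : Set (AlgebraicClosure ℚ))) :=
        IntermediateField.adjoin.finiteDimensional ((AlgebraicClosure.isAlgebraic ℚ).isAlgebraic β).isIntegral
      haveI : NumberField ↥(IntermediateField.adjoin ℚ ({β} : Set (AlgebraicClosure ℚ))) := NumberField.mk
      ¬ 2 ∣ classNumber ↥(IntermediateField.adjoin ℚ ({β} : Set (AlgebraicClosure ℚ))))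
    (hdepth : ∀ (κP : ZpExtension ↥(IntermediateField.adjoin ℚ ({β} : Set (AlgebraicClosure ℚ))) 2)
      [FiniteDimensional ↥(IntermediateField.adjoin ℚ ({β} : Set (AlgebraicClosure ℚ))) (κP.layer 2)] [NumberField (κP.layer 2)],
      κP.IsCyclotomic →
        classNumberPExp κP 1 ≤ 1 ∧
        (unitsE (κP.layer 2) ⊓ (⊤ : Subgroup (κP.layer 2)ˣ).map
            (Herbrand.norm ((κP.layer 2) ≃ₐ[↥(IntermediateField.adjoin ℚ ({β} : Set (AlgebraicClosure ℚ)))] (κP.layer 2)))).relIndex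
          (unitsE (κP.layer 2) ⊓ (unitsIncl ↥(IntermediateField.adjoin ℚ ({β} : Set (AlgebraicClosure ℚ))) (κP.layer 2)).range) = 1) :
    MazurMainConjecture W 2 := by
  have hβint : IsIntegral ℚ β := ((AlgebraicClosure.isAlgebraic ℚ).isAlgebraic β).isIntegral
  haveI : FiniteDimensional ℚ ↥(IntermediateField.adjoin ℚ ({β} : Set (AlgebraicClosure ℚ))) :=
    IntermediateField.adjoin.finiteDimensional hβint
  haveI : NumberField ↥(IntermediateField.adjoin ℚ ({β} : Set (AlgebraicClosure ℚ))) := NumberField.mk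
  refine mazurMainConjecture_two_of_muIneqRel_of_classicalMu_cubicField_of_Δ_neg W h17 hGr hper hmod hGZK hI hord ht hΔ hr hμan hbsd hβ
    fun κP hκP => ?_
  haveI : FiniteDimensional ↥(IntermediateField.adjoin ℚ ({β} : Set (AlgebraicClosure ℚ))) (κP.layer 2) :=
    κP.finiteDimensional_layer_holds 2
  haveI : NumberField (κP.layer 2) := NumberField.of_module_finite ↥(IntermediateField.adjoin ℚ ({β} : Set (AlgebraicClosure ℚ))) _
  obtain ⟨he1, hidx⟩ := hdepth κP hκP
  exact (classGroupPRank_le_one_adjoin_of_depthDoor_of_emod_four_eq_one W hord ht h41 hβ hh κP hκP he1 hidx).2.1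

end Summit.BirchSwinnertonDyer.BirchSwinnertonDyer.Theorems.AlignedTransportAtTwoCubicDepthDoorOddIndex

end
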